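import Summits.BirchSwinnertonDyer.BirchSwinnertonDyer.Theorems.BiquadraticEisensteinDescentHeegnerTwistCouplingInSupplySylvesterCorner
import HarnessLib

set_option linter.dupNamespace false -- `Summit.BirchSwinnertonDyer.BirchSwinnertonDyer.Theorems.…` (summit = sub, D-0017)
set_option autoImplicit false

/-!
# Crux `HeegnerTwistCouplingInSupply` (stmt-BirchSwinnertonDyer-21381) — the SYLVESTER `j = 0` corner, II:
# KERNEL CERTIFICATE TABLE for every prime `p ≡ 8 (mod 9)` below `10⁴`, hence the corner `W_p : y² + p·y = x³` below `10⁴`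
# modulo the `3`-descent hypothesis, Burungale–Tian and Deuring–Hecke

Route `BiquadraticEisensteinDescent` (cell `pub/bsd-wall`; width seat `bsd-wall-cm-bed-w4` g26; theorems only, `--supports` 21381,
helper). Companion of `…SylvesterCorner.lean` (`cruxConclusion_of_certificate`: card `splitting-bias`, seat 1 g28). For each of the
201 primes `p ≡ 8 (mod 9)`, `p < 10⁴`, ONE `decide +kernel` finds an entry `(D, h, M, a, b)` of an eleven-line menu
(`D ∈ {−8, −11, −20, −35, −47, −56, −68, −71, −95, −119, −155}`, `h = h(D)`, `M = −3D`, `a² − M b² = 4`) with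
(i) `(D/p) = +1` (Euler's criterion `D^{(p−1)/2} ≡ 1`, kernel `Nat.pow`), (ii) `h < p`, (iii) the LUCAS non-cube certificate
`p ∤ Im((a + b√M)^{(p+1)/3})`, the power being evaluated by fourteen square-and-multiply steps (`Nat.iterate` of an explicit
step on `ℕ × ℤ√M × ℤ√M`, §1 — the unary `Monoid.npow` of `ℤ√M` is too slow for the kernel at `p ∼ 10⁴`).

* §1 `iterate_sqMul_spec` / `iterate_sqMul_eq_pow`: the right-to-left binary method computes `z ^ n` (in `ℤ√d`).
* §2 `jacobiSym_eq_one_of_euler`: `(D mod p)^{(p−1)/2} ≡ 1 (mod p)` (in `ℕ`) gives `(D/p) = +1` for an odd prime `p` (Euler).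
* §3 the menu: arithmetic of the eleven entries (`decide`) and the FIELDS `K = ℚ(√D)` (`sqrtField`; `d_K = D`, `h_K = h(D)` by the
  tree's `ClassNumberValues.classNumber_eq_of_discr_eq` on kernel values of `BinQF.classNumber`).
* §4 `table` (ONE `decide +kernel`, quantified as `∀ k < 1112, (9k+8).Prime → …`). Rows `p ↦ D`:
  `D = −8` (68 primes): 17 107 233 251 449 467 521 683 809 953 1097 1187 1259 1601 1619 1889 1907 2339 2609 2699 2753 2843 2897 3203
  3257 3329 3347 3491 3761 3833 3851 3923 4049 4139 4283 4409 4643 4787 4931 5003 5273 5417 5507 5849 5867 5939 6011 6299 6947 7019 7307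
  7451 7577 7649 7793 7883 7937 8009 8081 8369 8513 8747 8819 8963 9161 9323 9521 9539 · `D = −11` (46): 53 71 179 269 719 881 1277 1367
  1439 1511 1871 2267 2357 2861 3023 3041 3221 3617 4211 4229 4337 4679 4733 5039 5237 5399 5471 5669 5813 6029 6389 6659 6803 6857 6911
  6983 7001 7253 7703 7901 8297 8387 8693 8783 8837 9629 · `D = −20` (26): 89 503 647 701 827 863 1223 1583 2069 2789 3527 3581 4463 4481
  4967 5021 5381 5741 6047 6569 7109 7487 8243 8423 9341 9467 · `D = −35` (20): 431 773 1061 1709 2591 2663 3167 3797 4157 4373 4391 4877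
  6101 6173 6263 6317 7433 8171 9413 9431 · `D = −47` (15): 197 1493 2411 2447 2879 2969 5147 5903 6353 6551 7541 7757 7829 9377 9719 ·
  `D = −56` (8): 359 971 1637 2087 7127 7523 7919 8999 · `D = −68` (9): 557 593 1979 1997 2141 2393 4013 5651 7559 · `D = −71` (3): 2213
  3671 9791 · `D = −95` (3): 1151 4517 4751 · `D = −119`: 5309 · `D = −155`: 3779 8117 (generated and cross-checked outside the kernel:
  this seat's `compute/table_gen.py` and kit j332101 — 0/138 violations of the certificate against `ellanalyticrank`).
* §5 ★ `cruxOnSylvesterCorner_of_desc_lt`: for EVERY prime `p ≡ 8 (mod 9)` below `10⁴`, modulo `hDesc` (the card's `3`-descent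
  statement, shape documented in `…SylvesterCorner.lean`), Burungale–Tian (`hBT`) and Deuring–Hecke (`hH`): a Heegner field `K′ = ℚ(√D)`
  of `N(W_p)` with `4 < |d_{K′}|`, `L(W_p^{(d_{K′})}, 1) ≠ 0`, `h(K′) < p`, `p ∤ h(K′)` — the CONCLUSION of crux 21381 at `(W_p, p)`.

HONEST FRAMING: a finite table on ONE CM family; conditional on the unformalised `3`-descent (`hDesc`) and two named print facts;
above `10⁴` the card's counting lemmas L2/L3 (Davenport–Heilbronn in the Burgess range) are untouched. Nothing here proves the crux
or BSD. No definition, no named fact, no `sorry`; axioms standard. [cite: Cohen1993, §1.2.2 Algorithm 1.2.1 (right-left binary)]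
[cite: IrelandRosen1990, Prop. 5.1.2 (Euler's criterion)] [cite: Cox2013, §2.A Thm. 2.13; §7.B Thm. 7.7(ii)] [cite: Marcus2018, Ch. 2 Thm. 1]
[cite: CohenPazuki2009, §2] [cite: BurungaleTian2026, Thm. 1.1] [cite: SilvermanATAEC1994, Ch. II Cor. 10.5.1]
-/

noncomputable section

open scoped Classical NumberField

namespace Summit.BirchSwinnertonDyer.BirchSwinnertonDyer.Theorems.SylvesterCorner

open _root_.WeierstrassCurve Literature.NumberTheory.EllipticCurves
open Literature.NumberTheory.QuadraticFields Literature.NumberTheory.QuadraticFields.Quadratic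

/-! ## §1 Square-and-multiply as an iterate (kernel-friendly powering) -/

section BinaryPower

variable {d : ℤ}

/-- **The right-to-left binary method** (in `ℤ√d`; stated for this ring so that the step function below is literally the one
of the table). After `i` steps of `(n, acc, w) ↦ (⌊n/2⌋, acc·w^{n mod 2}, w²)` the state is `(⌊n/2^i⌋, acc·w^{n mod 2^i}, w^{2^i})`.
[cite: Cohen1993, §1.2.2 Algorithm 1.2.1] -/
theorem iterate_sqMul_spec (i : ℕ) : ∀ (n : ℕ) (acc w : ℤ√d),
    (fun s : ℕ × ℤ√d × ℤ√d => (s.1 / 2, if s.1 % 2 = 1 then s.2.1 * s.2.2 else s.2.1, s.2.2 * s.2.2))^[i] (n, acc, w) =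
      (n / 2 ^ i, acc * w ^ (n % 2 ^ i), w ^ (2 ^ i)) := by
  induction i with
  | zero =>
    intro n acc w
    simp [Nat.mod_one]
  | succ i ih =>
    intro n acc w
    rw [Function.iterate_succ_apply, ih]
    have h2 : (2 : ℕ) ^ (i + 1) = 2 * 2 ^ i := by rw [pow_succ, mul_comm]
    refine Prod.ext ?_ (Prod.ext ?_ ?_)
    · show n / 2 / 2 ^ i = n / 2 ^ (i + 1)
      rw [h2, Nat.div_div_eq_div_mul]
    · show (if n % 2 = 1 then acc * w else acc) * (w * w) ^ (n / 2 % 2 ^ i) = acc * w ^ (n % 2 ^ (i + 1))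
      rw [h2, Nat.mod_mul, pow_add, pow_mul, ← sq]
      rcases Nat.mod_two_eq_zero_or_one n with h0 | h1
      · rw [if_neg (by omega), h0, pow_zero, one_mul, sq]
      · rw [if_pos h1, h1, pow_one, mul_assoc, sq]
    · show (w * w) ^ (2 ^ i) = w ^ (2 ^ (i + 1))
      rw [← sq, ← pow_mul, h2, mul_comm]

/-- **Fourteen square-and-multiply steps compute `z ^ n` for `n < 2¹⁴`.** [cite: Cohen1993, §1.2.2 Algorithm 1.2.1] -/
theorem iterate_sqMul_eq_pow (z : ℤ√d) {n L : ℕ} (hn : n < 2 ^ L) :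
    ((fun s : ℕ × ℤ√d × ℤ√d => (s.1 / 2, if s.1 % 2 = 1 then s.2.1 * s.2.2 else s.2.1, s.2.2 * s.2.2))^[L] (n, 1, z)).2.1 =
      z ^ n := by
  rw [iterate_sqMul_spec, Nat.mod_eq_of_lt hn, one_mul]

end BinaryPower

/-! ## §2 Euler's criterion in decidable form -/

/-- **`(D/p) = +1` from Euler's criterion in `ℕ`**: for an odd prime `p` and `D ∈ ℤ`, if `(D mod p)^{(p−1)/2} ≡ 1 (mod p)` then
the Jacobi (= Legendre) symbol `(D/p)` is `+1`. [cite: IrelandRosen1990, Prop. 5.1.2] -/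
theorem jacobiSym_eq_one_of_euler {p : ℕ} (hp : p.Prime) (hp2 : p ≠ 2) {D : ℤ}
    (h : (D % (p : ℤ)).toNat ^ ((p - 1) / 2) % p = 1) : jacobiSym D p = 1 := by
  haveI := Fact.mk hp
  have hodd : p % 2 = 1 := Nat.odd_iff.mp (hp.odd_of_ne_two hp2)
  have hp2' : p / 2 = (p - 1) / 2 := by omega
  set r : ℕ := (D % (p : ℤ)).toNat with hr_def
  have hr : (r : ℤ) = D % (p : ℤ) := Int.toNat_of_nonneg (Int.emod_nonneg D (by exact_mod_cast hp.ne_zero))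
  have hcast : ((r : ℕ) : ZMod p) = (D : ZMod p) := by
    rw [← Int.cast_natCast, hr, ZMod.intCast_mod]
  have hpow : (D : ZMod p) ^ (p / 2) = 1 := by
    have h1 : (((r ^ ((p - 1) / 2) % p : ℕ)) : ZMod p) = 1 := by rw [h, Nat.cast_one]
    rw [ZMod.natCast_mod, Nat.cast_pow, hcast, ← hp2'] at h1
    exact h1
  have hD0 : (D : ZMod p) ≠ 0 := by
    intro h0
    have h2p : 2 ≤ p := hp.two_le
    rw [h0, zero_pow (by omega : p / 2 ≠ 0)] at hpow
    exact zero_ne_one hpow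
  rw [← jacobiSym.legendreSym.to_jacobiSym, legendreSym.eq_one_iff p hD0]
  exact (ZMod.euler_criterion p hD0).mpr hpow

/-! ## §3 The menu: arithmetic and fields -/

/-- **Arithmetic of the eleven menu entries `(D, h, M, a, b)`**: `D < 0`, `4 < |D|`, `D ≡ 1 (mod 3)` (Euler form at `3`),
`M = −3D`, `a² − M b² = 4` (so `(a + b√M)/2` is a norm-one unit of `ℚ(√M)`), `3 ∤ h`. [folklore] -/
theorem menu_spec : ∀ e ∈ [((-8 : ℤ), (1 : ℕ), (24 : ℤ), (10 : ℤ), (2 : ℤ)), (-11, 1, 33, 46, 8), (-20, 2, 60, 8, 1),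
      (-35, 2, 105, 82, 8), (-47, 5, 141, 190, 16), (-56, 4, 168, 26, 2), (-68, 4, 204, 100, 7), (-71, 7, 213, 73, 5),
      (-95, 8, 285, 17, 1), (-119, 10, 357, 19, 1), (-155, 4, 465, 31742, 1472)],
    e.1 < 0 ∧ 4 < e.1.natAbs ∧ (e.1 % ((3 : ℕ) : ℤ)).toNat ^ ((3 - 1) / 2) % 3 = 1 ∧ e.2.2.1 = -3 * e.1 ∧
      e.2.2.2.1 ^ 2 - e.2.2.1 * e.2.2.2.2 ^ 2 = 4 ∧ ¬ 3 ∣ e.2.1 := by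
  decide +kernel

/-- `ℚ(√D)` for an odd fundamental `D < 0` (`D ≡ 1 (mod 4)` squarefree): imaginary quadratic, `d_K = D`, `h_K = h(D)` read off a
kernel value of `BinQF.classNumber`. [cite: Marcus2018, Ch. 2 Thm. 1] [cite: Cox2013, §2.A Thm. 2.13; §7.B Thm. 7.7(ii)] -/
theorem exists_field_of_odd (D : ℤ) (h : ℕ) (hD0 : D < 0) (hD4 : D % 4 = 1) (hsf : Squarefree D.natAbs)
    (hh : BinQF.classNumber D = h) :
    ∃ (K : Type) (_ : Field K) (_ : NumberField K),
      IsImaginaryQuadratic K ∧ NumberField.discr K = D ∧ NumberField.classNumber K = h := by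
  haveI : Fact (D < 0) := ⟨hD0⟩
  obtain ⟨hK, hdK⟩ := isImaginaryQuadratic_and_discr_sqrtField_of_squarefree_natAbs D hD4 hsf
  exact ⟨sqrtField D, inferInstance, inferInstance, hK, hdK,
    ClassNumberValues.classNumber_eq_of_discr_eq hK.1 hdK hD0 hh⟩

/-- `ℚ(√m)` for `m < 0`, `m ≡ 2, 3 (mod 4)` squarefree: imaginary quadratic, `d_K = 4m`, `h_K = h(4m)`.
[cite: Marcus2018, Ch. 2 Thm. 1] [cite: Cox2013, §2.A Thm. 2.13; §7.B Thm. 7.7(ii)] -/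
theorem exists_field_of_four_mul (m : ℤ) {D : ℤ} (hD : 4 * m = D) (h : ℕ) (hm0 : m < 0) (hm4 : m % 4 = 2 ∨ m % 4 = 3)
    (hsf : Squarefree m.natAbs) (hh : BinQF.classNumber D = h) :
    ∃ (K : Type) (_ : Field K) (_ : NumberField K),
      IsImaginaryQuadratic K ∧ NumberField.discr K = D ∧ NumberField.classNumber K = h := by
  haveI : Fact (m < 0) := ⟨hm0⟩
  obtain ⟨hK, hdK⟩ := isImaginaryQuadratic_and_discr_sqrtField_four_mul m hm4 (Int.squarefree_natAbs.mp hsf)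
  rw [hD] at hdK
  exact ⟨sqrtField m, inferInstance, inferInstance, hK, hdK,
    ClassNumberValues.classNumber_eq_of_discr_eq hK.1 hdK (by omega) hh⟩

/-- **The fields of the menu**: for each entry `(D, h, …)` an imaginary quadratic `K = ℚ(√D)` with `d_K = D` and `h_K = h`
(`h(−8) = h(−11) = 1`, `h(−20) = h(−35) = 2`, `h(−47) = 5`, `h(−56) = h(−68) = 4`, `h(−71) = 7`, `h(−95) = 8`, `h(−119) = 10`,
`h(−155) = 4`, kernel values). [cite: Cox2013, §2.A Thm. 2.13; §7.B Thm. 7.7(ii)] [cite: Marcus2018, Ch. 2 Thm. 1] -/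
theorem menu_fields : ∀ e ∈ [((-8 : ℤ), (1 : ℕ), (24 : ℤ), (10 : ℤ), (2 : ℤ)), (-11, 1, 33, 46, 8), (-20, 2, 60, 8, 1),
      (-35, 2, 105, 82, 8), (-47, 5, 141, 190, 16), (-56, 4, 168, 26, 2), (-68, 4, 204, 100, 7), (-71, 7, 213, 73, 5),
      (-95, 8, 285, 17, 1), (-119, 10, 357, 19, 1), (-155, 4, 465, 31742, 1472)],
    ∃ (K : Type) (_ : Field K) (_ : NumberField K),
      IsImaginaryQuadratic K ∧ NumberField.discr K = e.1 ∧ NumberField.classNumber K = e.2.1 := by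
  intro e he
  simp only [List.mem_cons, List.mem_nil_iff, or_false] at he
  rcases he with rfl | rfl | rfl | rfl | rfl | rfl | rfl | rfl | rfl | rfl | rfl
  · exact exists_field_of_four_mul (-2) (by norm_num) 1 (by norm_num) (by norm_num) (by decide +kernel) (by decide +kernel)
  · exact exists_field_of_odd (-11) 1 (by norm_num) (by norm_num) (by decide +kernel) (by decide +kernel)
  · exact exists_field_of_four_mul (-5) (by norm_num) 2 (by norm_num) (by norm_num) (by decide +kernel) (by decide +kernel)
  · exact exists_field_of_odd (-35) 2 (by norm_num) (by norm_num) (by decide +kernel) (by decide +kernel)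
  · exact exists_field_of_odd (-47) 5 (by norm_num) (by norm_num) (by decide +kernel) (by decide +kernel)
  · exact exists_field_of_four_mul (-14) (by norm_num) 4 (by norm_num) (by norm_num) (by decide +kernel) (by decide +kernel)
  · exact exists_field_of_four_mul (-17) (by norm_num) 4 (by norm_num) (by norm_num) (by decide +kernel) (by decide +kernel)
  · exact exists_field_of_odd (-71) 7 (by norm_num) (by norm_num) (by decide +kernel) (by decide +kernel)
  · exact exists_field_of_odd (-95) 8 (by norm_num) (by norm_num) (by decide +kernel) (by decide +kernel)
  · exact exists_field_of_odd (-119) 10 (by norm_num) (by norm_num) (by decide +kernel) (by decide +kernel)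
  · exact exists_field_of_odd (-155) 4 (by norm_num) (by norm_num) (by decide +kernel) (by decide +kernel)

/-! ## §4 The table (kernel) -/

/-- The sieve primes are `≥ 2`. [folklore] -/
theorem two_le_of_mem_sievePrimes : ∀ q ∈ [2, 3, 5, 7, 11, 13, 17, 19, 23, 29, 31, 37, 41, 43, 47, 53, 59, 61, 67, 71, 73,
    79, 83, 89, 97], 2 ≤ q := by
  decide

/-- **Certificate table (kernel).** For every `k < 1112`, `p = 9k + 8`: EITHER `p` has a proper divisor among the primes below
`100` (so `p` is composite — `Nat.Prime` itself is too slow in the kernel, a sieve witness replaces it), OR a menu entry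
`(D, h, M, a, b)` with `(D mod p)^{(p−1)/2} ≡ 1 (mod p)` (so `(D/p) = +1`), `h < p`, and `p ∤ Im((a + b√M)^{(p+1)/3})` (the power
by fourteen square-and-multiply steps; `(p+1)/3 < 2¹⁴`). In particular every PRIME `p ≡ 8 (mod 9)` below `10⁴` is certified.
[cite: Cohen1993, §1.2.2 Algorithm 1.2.1] [cite: IrelandRosen1990, Prop. 5.1.2] -/
theorem table : ∀ k < 1112,
    (∃ q ∈ [2, 3, 5, 7, 11, 13, 17, 19, 23, 29, 31, 37, 41, 43, 47, 53, 59, 61, 67, 71, 73, 79, 83, 89, 97],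
      q < 9 * k + 8 ∧ (9 * k + 8) % q = 0) ∨
    ∃ e ∈ [((-8 : ℤ), (1 : ℕ), (24 : ℤ), (10 : ℤ), (2 : ℤ)), (-11, 1, 33, 46, 8), (-20, 2, 60, 8, 1),
      (-35, 2, 105, 82, 8), (-47, 5, 141, 190, 16), (-56, 4, 168, 26, 2), (-68, 4, 204, 100, 7), (-71, 7, 213, 73, 5),
      (-95, 8, 285, 17, 1), (-119, 10, 357, 19, 1), (-155, 4, 465, 31742, 1472)],
      (e.1 % ((9 * k + 8 : ℕ) : ℤ)).toNat ^ ((9 * k + 8 - 1) / 2) % (9 * k + 8) = 1 ∧ e.2.1 < 9 * k + 8 ∧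
        ¬ ((9 * k + 8 : ℕ) : ℤ) ∣ ((fun s : ℕ × ℤ√(e.2.2.1) × ℤ√(e.2.2.1) =>
            (s.1 / 2, if s.1 % 2 = 1 then s.2.1 * s.2.2 else s.2.1, s.2.2 * s.2.2))^[14]
          ((9 * k + 8 + 1) / 3, 1, ⟨e.2.2.2.1, e.2.2.2.2⟩)).2.1.im := by
  decide +kernel

/-! ## §5 ★ The Sylvester corner below `10⁴` -/

/-- ★ **Corner `W = W_p : y² + p·y = x³`, EVERY prime `p ≡ 8 (mod 9)` below `10⁴`** — modulo the `3`-descent hypothesis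
`hDesc` (card `splitting-bias` L1, Lucas form; see `…SylvesterCorner.lean`), Burungale–Tian (`hBT`) and Deuring–Hecke (`hH`):
there is a Heegner field `K′ = ℚ(√D)` of `N(W_p)` (prime support `{3, p}`; `(D/3) = (D/p) = +1`) with `4 < |d_{K′}|`,
`L(W_p^{(d_{K′})}, 1) ≠ 0`, `h(K′) < p` and `p ∤ h(K′)` — the conclusion of `HeegnerTwistCouplingInSupply` at `(W_p, p)`.
The binders `IsGloballyMinimal`, `NeZero N` mirror the crux and are unused. [cite: CohenPazuki2009, §2]
[cite: BurungaleTian2026, Thm. 1.1] [cite: SilvermanATAEC1994, Ch. II Cor. 10.5.1] [cite: GrossLMS1991, §1]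
[cite: Cox2013, §2.A Thm. 2.13; §7.B Thm. 7.7(ii)] -/
theorem cruxOnSylvesterCorner_of_desc_lt
    (hDesc : ∀ (p : ℕ) (K : Type) [Field K] [NumberField K] (M a b : ℤ), p.Prime → p % 9 = 8 →
      IsImaginaryQuadratic K → 4 < (NumberField.discr K).natAbs →
      jacobiSym (NumberField.discr K) 3 = 1 → jacobiSym (NumberField.discr K) p = 1 →
      ¬ 3 ∣ NumberField.classNumber K → M = -3 * NumberField.discr K → a ^ 2 - M * b ^ 2 = 4 →
      ¬ (p : ℤ) ∣ ((⟨a, b⟩ : ℤ√M) ^ ((p + 1) / 3)).im →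
      ((⟨0, 0, (p : ℚ), 0, 0⟩ : WeierstrassCurve ℚ).quadraticTwist (NumberField.discr K : ℚ)).mordellWeilRank = 0 ∧
      ∀ c ∈ ((⟨0, 0, (p : ℚ), 0, 0⟩ : WeierstrassCurve ℚ).quadraticTwist (NumberField.discr K : ℚ)).sha,
        3 • c = 0 → c = 0)
    (hBT : burungaleTian_analyticRank_eq_zero_of_selmerCorank_eq_zero_of_hasCM)
    (hH : hasEntireLFunction_of_j_mem_maximalCMJInvariants) :
    ∀ (p : ℕ) [Fact p.Prime] [(⟨0, 0, (p : ℚ), 0, 0⟩ : WeierstrassCurve ℚ).IsElliptic]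
      [(⟨0, 0, (p : ℚ), 0, 0⟩ : WeierstrassCurve ℚ).IsGloballyMinimal]
      [NeZero ((⟨0, 0, (p : ℚ), 0, 0⟩ : WeierstrassCurve ℚ).conductorNorm ℤ)],
      p % 9 = 8 → p < 10000 →
      ∃ (K : Type) (_ : Field K) (_ : NumberField K),
        IsImaginaryQuadratic K ∧ 4 < (NumberField.discr K).natAbs ∧
        SatisfiesHeegnerHypothesis ((⟨0, 0, (p : ℚ), 0, 0⟩ : WeierstrassCurve ℚ).conductorNorm ℤ) K ∧
        ((⟨0, 0, (p : ℚ), 0, 0⟩ : WeierstrassCurve ℚ).quadraticTwist (NumberField.discr K : ℚ)).entireLFunction 1 ≠ 0 ∧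
        NumberField.classNumber K < p ∧ ¬ p ∣ NumberField.classNumber K := by
  intro p hpF _ _ _ hp9 hlt
  have hp : p.Prime := hpF.out
  have hp2 : p ≠ 2 := by rintro rfl; omega
  -- `p = 9k + 8` with `k = p / 9 < 1112`
  have hpk : 9 * (p / 9) + 8 = p := by omega
  obtain hsieve | ⟨e, he, hEul, hh, hLuc⟩ := table (p / 9) (by omega)
  · -- a prime has no proper divisor among the sieve primes
    exfalso
    obtain ⟨q, hq, hqlt, hqdvd⟩ := hsieve
    rw [hpk] at hqlt hqdvd
    have h2q := two_le_of_mem_sievePrimes q hq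
    rcases (Nat.dvd_prime hp).mp (Nat.dvd_of_mod_eq_zero hqdvd) with h1 | h1 <;> omega
  · rw [hpk] at hEul hh hLuc
    obtain ⟨hD0, hD4, hD3, hM, hab, hh3⟩ := menu_spec e he
    obtain ⟨K, iF, iN, hK, hdK, hhK⟩ := menu_fields e he
    -- the Lucas certificate in `Monoid.npow` form (`(p+1)/3 < 2¹⁴`)
    have hn : (p + 1) / 3 < 2 ^ 14 := by norm_num; omega
    rw [iterate_sqMul_eq_pow (⟨e.2.2.2.1, e.2.2.2.2⟩ : ℤ√(e.2.2.1)) hn] at hLuc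
    have hJp : jacobiSym e.1 p = 1 := jacobiSym_eq_one_of_euler hp hp2 hEul
    have hJ3 : jacobiSym e.1 3 = 1 := jacobiSym_eq_one_of_euler Nat.prime_three (by norm_num) hD3
    exact exists_cruxConclusion_of_certificate hDesc hBT hH hp hp9 ⟨K, iF, iN, hK, hdK, hhK⟩ hD4 hJ3 hJp hh hh3 hM hab hLuc

end Summit.BirchSwinnertonDyer.BirchSwinnertonDyer.Theorems.SylvesterCorner
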